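import Mathlib
import HarnessLib
import Literature.Analysis.FluidPDE.TypeIAncientMild
import Literature.Analysis.FluidPDE.NSWeakProductRule
import Summits.NavierStokesRegularity.NavierStokesRegularity.Theorems.PoloidalWindowDoorPoloidalWindowRigidityPoloidalExtremal
import Summits.NavierStokesRegularity.NavierStokesRegularity.Theorems.PoloidalWindowDoorPoloidalWindowRigiditySymmetryGerms

/-!
# Route `PoloidalWindowDoor`, crux `PoloidalWindowRigidity` (stmt-NavierStokesRegularity-19708) — LINE 26 «eternal_web» v1.0
# (ns-idea-8 g12, `Cruxes/PoloidalWindowRigidity/Lines/eternal_web.lean` fe3084e4134f, §18): hand stub U4b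
# `stub_verticalCore : VerticalCore`, VERBATIM (the Cruxes-local `VerticalCore` unfolded — it mentions only Literature names)

Seat ns-poloidal-K2-p2 g15 (D-0081 §C stub-worker on ⟨19708⟩; CLAIM announced on the cell bus before proposing;
`--supports stmt-NavierStokesRegularity-19708 --as helper`).

* `verticalCore` — **THE VERTICAL CORE: quantitative unique continuation along the poloidal axis.**  For every Type-I
  constant `C`, speed threshold `ε₀ > 0` and aperture `A > 0` there is `δ = δ(C, ε₀, A) > 0` such that every e₂-poloidal
  element `U` of the Type-I ancient mild class `A_C` (`Literature.Analysis.FluidPDE.IsTypeIAncientMild C U`,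
  `⟪curl U(s), e₂⟫ ≡ 0`) with scale-invariant speed `√(−r)‖U(r,y)‖ ≥ ε₀` at a point `(r, y)` has, AT THE SAME TIME and
  within `‖x − y‖ ≤ A√(−r)`, scale-invariant VERTICAL speed `√(−r)|U₂(r,x)| ≥ δ`.

PROOF (template: U3a `…LeastPinAnisotropicGap.anisotropicGap`, p709185 — the same extraction).  If not, there are poloidal
`Uₖ ∈ A_C` and points `(rₖ, yₖ)`, `rₖ < 0`, with `√(−rₖ)‖Uₖ(rₖ, yₖ)‖ ≥ ε₀` but `√(−rₖ)|Uₖ,₂(rₖ, x)| < 1/(k+1)` on the whole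
ball `‖x − yₖ‖ ≤ A√(−rₖ)`.  The renormalised fields `wₖ := nsRescale √(−rₖ) (Uₖ(·, yₖ + ·))` are in `A_C`
(`isTypeIAncientMild_nsRescale ∘ isTypeIAncientMild_translate`), e₂-poloidal (`poloidal_nsRescale ∘ poloidal_translate`), have
`‖wₖ(−1, 0)‖ ≥ ε₀` and `|wₖ,₂(−1, z)| < 1/(k+1)` for `‖z‖ ≤ A` (the renormalisation maps `(rₖ, yₖ) ↦ (−1, 0)` and the ball
onto `‖z‖ ≤ A`).  A KNSS limit with gradients (`Theorems.exists_tendsto_of_isTypeIAncientMild_seq`) `W ∈ A_C` is poloidal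
(`poloidal_of_tendsto`), has `‖W(−1, 0)‖ ≥ ε₀` and `W₂(−1, ·) ≡ 0` on `‖z‖ ≤ A`; hence `∂₀W₂(−1, ·) ≡ 0` on the open ball
`‖z‖ < A` (nonempty as `A > 0`), and the tree's vertical rigidity `…SymmetryGerms.eq_zero_of_horizontalGradient_eq_zero_on_open`
(horizontal derivative of `v₂` vanishing on a nonempty open set at one poloidal time forces `v ≡ 0`) kills `W` —
contradiction with `‖W(−1, 0)‖ ≥ ε₀ > 0`.

HONEST LABEL: ONE support stub (hand U4b, M) of a files-only line (critic idea-crit-7 g9 PASS 10:59Z before typing); it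
closes no cell, no crux and no route item; the research cells `CellEternalWeb` / `CellBreathing`, ⟨19708⟩ / ⟨20428⟩ /
⟨27893⟩ and NS regularity stay OPEN — no summit statement is proved here.
-/

noncomputable section

-- the summit and its single sub-problem share the name (CONVENTIONS §1), as in every Theorems file
set_option linter.dupNamespace false

namespace Summit.NavierStokesRegularity.NavierStokesRegularity.Theorems.PoloidalWindowDoorPoloidalWindowRigidityEternalWebVerticalCore

open Set Function Filter Topology Metric
open scoped RealInnerProductSpace InnerProductSpace
open Literature.Analysis Literature.Analysis.FluidPDE
open Summit.NavierStokesRegularity.NavierStokesRegularity.Theorems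
open Summit.NavierStokesRegularity.NavierStokesRegularity.Theorems.PoloidalWindowDoorPoloidalWindowRigidityPoloidalExtremal

/-! ## Vertical rigidity at one time, from an open ball -/

/-- **Vertical rigidity from a ball** (from the tree's `…SymmetryGerms.eq_zero_of_horizontalGradient_eq_zero_on_open`): an
e₂-poloidal-at-time-`s` element of `A_C` whose vertical component vanishes on an open ball of positive radius at that time
is `≡ 0` on the whole past. -/
theorem eq_zero_of_coordTwo_eq_zero_on_ball {C : ℝ} {W : ℝ → EuclideanSpace ℝ (Fin 3) → EuclideanSpace ℝ (Fin 3)}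
    (hW : IsTypeIAncientMild C W) {s : ℝ} (hs : s < 0) (hpol : ∀ y, ⟪curl (W s) y, EuclideanSpace.single 2 1⟫_ℝ = 0)
    {z₀ : EuclideanSpace ℝ (Fin 3)} {A : ℝ} (hA : 0 < A) (h2 : ∀ z ∈ ball z₀ A, W s z 2 = 0) :
    ∀ t < 0, ∀ x, W t x = 0 := by
  have hD : ∀ z ∈ ball z₀ A, fderiv ℝ (W s) z (EuclideanSpace.single 0 1) 2 = 0 := by
    intro z hz
    have hdiff : DifferentiableAt ℝ (W s) z := ((hW.contDiff_slice hs).differentiable (by simp)) z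
    rw [← fderiv_coord_apply hdiff 2 (EuclideanSpace.single 0 1)]
    have hev : (fun y => W s y 2) =ᶠ[𝓝 z] fun _ => (0 : ℝ) :=
      Filter.eventually_of_mem (isOpen_ball.mem_nhds hz) fun y hy => h2 y hy
    rw [hev.fderiv_eq]
    simp
  exact PoloidalWindowDoorPoloidalWindowRigiditySymmetryGerms.eq_zero_of_horizontalGradient_eq_zero_on_open hW.hasTypeITimeDecay
    hW.continuousOn_uncurry (fun s t hst ht x => hW.mild_eq_heatExtension hst ht x) (fun t ht => hW.isDivFree ht) hs hpol
    isOpen_ball (nonempty_ball.2 hA) hD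

/-! ## The stub -/

/-- **U4b `VerticalCore` (VERBATIM, the Cruxes-local def unfolded): the vertical core** — for every `C`, `ε₀ > 0`, `A > 0`
there is `δ > 0` such that every e₂-poloidal class-`C` profile with `√(−r)‖U(r,y)‖ ≥ ε₀` has a point `x`,
`‖x − y‖ ≤ A√(−r)`, with `√(−r)|U₂(r,x)| ≥ δ` (module docstring for the proof). -/
theorem verticalCore :
    ∀ C ε₀ A : ℝ, 0 < ε₀ → 0 < A → ∃ δ : ℝ, 0 < δ ∧
      ∀ U : ℝ → EuclideanSpace ℝ (Fin 3) → EuclideanSpace ℝ (Fin 3), IsTypeIAncientMild C U →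
        (∀ s < 0, ∀ y, ⟪curl (U s) y, EuclideanSpace.single 2 1⟫_ℝ = 0) →
        ∀ r : ℝ, r < 0 → ∀ y : EuclideanSpace ℝ (Fin 3), ε₀ ≤ Real.sqrt (-r) * ‖U r y‖ →
          ∃ x : EuclideanSpace ℝ (Fin 3), ‖x - y‖ ≤ A * Real.sqrt (-r) ∧ δ ≤ Real.sqrt (-r) * |U r x 2| := by
  intro C ε₀ A hε₀ hA
  by_contra hcon
  push Not at hcon
  -- violators `U k`: poloidal, class `C`, fast at `(r k, y k)`, vertically `1/(k+1)`-small on the ball `‖x − y k‖ ≤ A√(−r k)`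
  have hch : ∀ k : ℕ, ∃ U : ℝ → EuclideanSpace ℝ (Fin 3) → EuclideanSpace ℝ (Fin 3), IsTypeIAncientMild C U ∧
      (∀ s < 0, ∀ y, ⟪curl (U s) y, EuclideanSpace.single 2 1⟫_ℝ = 0) ∧
      ∃ r : ℝ, r < 0 ∧ ∃ y : EuclideanSpace ℝ (Fin 3), ε₀ ≤ Real.sqrt (-r) * ‖U r y‖ ∧
        ∀ x : EuclideanSpace ℝ (Fin 3), ‖x - y‖ ≤ A * Real.sqrt (-r) → Real.sqrt (-r) * |U r x 2| < 1 / ((k : ℝ) + 1) :=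
    fun k => hcon (1 / ((k : ℝ) + 1)) (by positivity)
  choose Uk hUk hUkpol rk hrk yk hyk hsmall using hch
  -- renormalisation to the point `(−1, 0)`
  set wk : ℕ → ℝ → EuclideanSpace ℝ (Fin 3) → EuclideanSpace ℝ (Fin 3) := fun k =>
    nsRescale (Real.sqrt (-rk k)) (fun t x => Uk k t (yk k + x)) with hwk_def
  have hck : ∀ k, 0 < Real.sqrt (-rk k) := fun k => Real.sqrt_pos.2 (neg_pos.2 (hrk k))
  have hwk : ∀ k, IsTypeIAncientMild C (wk k) := fun k =>
    isTypeIAncientMild_nsRescale (isTypeIAncientMild_translate (hUk k) (yk k)) (hck k)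
  have hwkpol : ∀ k, ∀ s < 0, ∀ y, ⟪curl (wk k s) y, EuclideanSpace.single 2 (1 : ℝ)⟫_ℝ = 0 := fun k =>
    poloidal_nsRescale (poloidal_translate (hUkpol k) (yk k)) (hck k)
  have hw_apply : ∀ k s y, wk k s y =
      Real.sqrt (-rk k) • Uk k (Real.sqrt (-rk k) ^ 2 * s) (yk k + Real.sqrt (-rk k) • y) := fun k s y => by
    simp [hwk_def, nsRescale_apply]
  have hw_one : ∀ k y, wk k (-1) y = Real.sqrt (-rk k) • Uk k (rk k) (yk k + Real.sqrt (-rk k) • y) := fun k y => by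
    rw [hw_apply, mul_neg_one, Real.sq_sqrt (neg_nonneg.2 (hrk k).le), neg_neg]
  -- fast at `(−1, 0)`
  have hlow : ∀ k, ε₀ ≤ ‖wk k (-1) 0‖ := fun k => by
    rw [hw_one, smul_zero, add_zero, norm_smul, Real.norm_of_nonneg (Real.sqrt_nonneg _)]
    exact hyk k
  -- vertically small on the ball `‖z‖ ≤ A` at time `−1`
  have hwk2 : ∀ k, ∀ z : EuclideanSpace ℝ (Fin 3), ‖z‖ ≤ A → |wk k (-1) z 2| < 1 / ((k : ℝ) + 1) := by
    intro k z hz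
    have hball : ‖(yk k + Real.sqrt (-rk k) • z) - yk k‖ ≤ A * Real.sqrt (-rk k) := by
      rw [add_sub_cancel_left, norm_smul, Real.norm_of_nonneg (Real.sqrt_nonneg _)]
      calc Real.sqrt (-rk k) * ‖z‖ ≤ Real.sqrt (-rk k) * A := by gcongr
        _ = A * Real.sqrt (-rk k) := mul_comm _ _
    have h := hsmall k _ hball
    rw [hw_one, PiLp.smul_apply, smul_eq_mul, abs_mul, abs_of_pos (hck k)]
    exact h
  -- KNSS compactness, fields AND gradients
  obtain ⟨φ, hφ, W, hW, hpt, hDpt, -, -⟩ := exists_tendsto_of_isTypeIAncientMild_seq C hwk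
  have hneg1 : (-1 : ℝ) < 0 := by norm_num
  have hWpol : ∀ s < 0, ∀ y, ⟪curl (W s) y, EuclideanSpace.single 2 (1 : ℝ)⟫_ℝ = 0 := fun s hs y =>
    poloidal_of_tendsto (hDpt s hs y) fun j => hwkpol (φ j) s hs y
  -- `‖W(−1, 0)‖ ≥ ε₀`
  have hW1 : ε₀ ≤ ‖W (-1) 0‖ :=
    ge_of_tendsto ((hpt (-1) hneg1 0).norm) (Eventually.of_forall fun j => hlow (φ j))
  -- `W₂(−1, ·) ≡ 0` on the ball `‖z‖ < A`
  have hW2 : ∀ z ∈ ball (0 : EuclideanSpace ℝ (Fin 3)) A, W (-1) z 2 = 0 := by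
    intro z hz
    have hzA : ‖z‖ ≤ A := by
      rw [mem_ball, dist_zero_right] at hz
      exact hz.le
    have hcoord : Tendsto (fun j => wk (φ j) (-1) z 2) atTop (𝓝 (W (-1) z 2)) :=
      ((EuclideanSpace.proj (2 : Fin 3) : EuclideanSpace ℝ (Fin 3) →L[ℝ] ℝ).continuous.tendsto _).comp (hpt (-1) hneg1 z)
    have habs : Tendsto (fun j => |wk (φ j) (-1) z 2|) atTop (𝓝 |W (-1) z 2|) := hcoord.abs
    have hrhs : Tendsto (fun j : ℕ => 1 / ((j : ℝ) + 1)) atTop (𝓝 0) := tendsto_one_div_add_atTop_nhds_zero_nat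
    have hle : ∀ j, |wk (φ j) (-1) z 2| ≤ 1 / ((j : ℝ) + 1) := by
      intro j
      refine (hwk2 (φ j) z hzA).le.trans ?_
      have hj : (j : ℝ) ≤ (φ j : ℝ) := by exact_mod_cast hφ.id_le j
      gcongr
    have h0 : |W (-1) z 2| ≤ 0 := le_of_tendsto_of_tendsto' habs hrhs hle
    exact abs_nonpos_iff.1 h0
  -- vertical rigidity at the poloidal time `−1`: `W₂(−1, ·) ≡ 0` on the ball forces `W ≡ 0`
  have hzero : ∀ t < 0, ∀ x, W t x = 0 :=
    eq_zero_of_coordTwo_eq_zero_on_ball hW hneg1 (hWpol (-1) hneg1) hA hW2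
  -- contradiction at `(−1, 0)`
  have h0 : W (-1) 0 = 0 := hzero (-1) hneg1 0
  rw [h0, norm_zero] at hW1
  exact absurd hW1 (not_le.2 hε₀)

end Summit.NavierStokesRegularity.NavierStokesRegularity.Theorems.PoloidalWindowDoorPoloidalWindowRigidityEternalWebVerticalCore

end
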